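import Mathlib.Data.List.Chain
import Mathlib.GroupTheory.Perm.List
import Mathlib.Logic.Relation
import Mathlib.Algebra.BigOperators.Group.List.Basic
import Mathlib.Tactic.Linarith
import Mathlib.Tactic.Ring

/-!
# Potentials for difference constraints whose simple closed walks have weight zero

Generic combinatorial lemma used by the WIDTH line of crux `MonotoneCoverHard`
(stmt-ValiantsHypothesis-7421; val-width-7421-p2 g0, 2026-08-27) to build the LEVEL FUNCTION of a
label-bijective cover.  Setting: a relation `arc` on a type `α` and an integer weight `Λ u v` on arcs;
a WALK is a nonempty list that `List.IsChain arc`; its weight is the sum of `Λ` over consecutive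
entries, written `(List.zipWith Λ l l.tail).sum` throughout (no definitions are introduced).

* `sum_zipWith_append_cons` — weight is additive under concatenation at a shared vertex;
* `exists_split_of_not_nodup` — a list with a repeated entry splits as `A ++ x :: (B ++ x :: C)`;
* `sum_zipWith_eq_zero_of_closed` — if every SIMPLE closed walk (head = last, tail duplicate-free)
  has weight `0`, then EVERY closed walk has weight `0` (split at a repeated vertex, induct);
* `exists_return_walk` — if every arc can be walked back (`arc u v →` a walk from `v` to `u`), every
  walk can be walked back;
* `exists_potential` — under these two hypotheses there is `φ : α → ℤ` with `φ v = φ u + Λ u v` on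
  every arc (path independence from closed-walk-zero; roots chosen through the quotient by mutual
  reachability);
* `sum_zipWith_cycle_eq_sum_map_formPerm`, `arc_formPerm_of_isChain_cycle` — the weight of the simple
  closed walk `c ++ [c.head]` is `Σ_{x ∈ c} Λ x (c.formPerm x)` and `c.formPerm` steps along arcs: the
  form in which the cover file (`…LevelFunction.lean`) discharges the cycle hypothesis.

Pure list combinatorics; VP ≠ VNP is not moved.
-/

namespace Summit.ValiantsHypothesis.ValiantsHypothesis.Theorems.PolyaContinuedMonotoneCoverHard

-- summit = sub-problem name (single-conjunct summit, D-0017 layout), so the namespace repeats it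
set_option linter.dupNamespace false

open List

section Walks

variable {α : Type*} (arc : α → α → Prop) (Λ : α → α → ℤ)

/-- Weight of a two-step extension. -/
theorem sum_zipWith_cons_cons (a b : α) (t : List α) :
    (List.zipWith Λ (a :: b :: t) (a :: b :: t).tail).sum =
      Λ a b + (List.zipWith Λ (b :: t) (b :: t).tail).sum := by
  simp [List.tail]

/-- A one-vertex walk has weight `0`. -/
theorem sum_zipWith_singleton (a : α) : (List.zipWith Λ [a] [a].tail).sum = 0 := by simp

/-- Additivity of the weight at a shared vertex: `W (P ++ v :: Q) = W (P ++ [v]) + W (v :: Q)`. -/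
theorem sum_zipWith_append_cons (P Q : List α) (v : α) :
    (List.zipWith Λ (P ++ v :: Q) (P ++ v :: Q).tail).sum =
      (List.zipWith Λ (P ++ [v]) (P ++ [v]).tail).sum +
        (List.zipWith Λ (v :: Q) (v :: Q).tail).sum := by
  induction P with
  | nil => simp
  | cons a P ih =>
    cases P with
    | nil => simp [List.zipWith]
    | cons b P' =>
      simp only [List.cons_append] at ih ⊢
      rw [sum_zipWith_cons_cons, sum_zipWith_cons_cons, ih]
      ring

/-- A list that is not duplicate-free splits around a repeated entry. -/
theorem exists_split_of_not_nodup : ∀ (l : List α), ¬ l.Nodup →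
    ∃ (A : List α) (x : α) (B C : List α), l = A ++ x :: (B ++ x :: C)
  | [], h => by simp at h
  | a :: t, h => by
    rw [List.nodup_cons, not_and_or, not_not] at h
    rcases h with h | h
    · obtain ⟨B, C, rfl⟩ := List.append_of_mem h
      exact ⟨[], a, B, C, rfl⟩
    · obtain ⟨A, x, B, C, rfl⟩ := exists_split_of_not_nodup t h
      exact ⟨a :: A, x, B, C, rfl⟩

/-- **Closed walks have weight zero if simple closed walks do.**  Here a closed walk is a nonempty
`arc`-chain whose head equals its last entry; it is simple when its tail is duplicate-free. -/
theorem sum_zipWith_eq_zero_of_closed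
    (HS : ∀ (l : List α) (hl : l ≠ []), List.IsChain arc l → l.head hl = l.getLast hl →
      l.tail.Nodup → (List.zipWith Λ l l.tail).sum = 0) :
    ∀ (N : ℕ) (l : List α) (hl : l ≠ []), l.length ≤ N → List.IsChain arc l →
      l.head hl = l.getLast hl → (List.zipWith Λ l l.tail).sum = 0 := by
  intro N
  induction N with
  | zero => intro l hl hlen; exact absurd (List.length_eq_zero_iff.1 (by omega)) hl
  | succ N ih =>
    intro l hl hlen hch hcl
    by_cases hnd : l.tail.Nodup
    · exact HS l hl hch hcl hnd
    obtain ⟨A, x, B, C, ht⟩ := exists_split_of_not_nodup l.tail hnd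
    obtain ⟨h, t, rfl⟩ : ∃ h t, l = h :: t := by
      cases l with
      | nil => exact absurd rfl hl
      | cons h t => exact ⟨h, t, rfl⟩
    simp only [List.tail_cons] at ht
    subst ht
    -- l = (h :: A) ++ x :: (B ++ x :: C)
    have e0 : h :: (A ++ x :: (B ++ x :: C)) = (h :: A) ++ x :: (B ++ x :: C) := rfl
    -- piece 1: x :: (B ++ [x]);  piece 2: (h :: A) ++ x :: C
    have hch1 : List.IsChain arc (x :: (B ++ [x])) := by
      refine hch.infix ⟨h :: A, C, ?_⟩
      simp
    have hch2 : List.IsChain arc ((h :: A) ++ x :: C) := by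
      rw [e0] at hch
      refine List.IsChain.append (hch.left_of_append) ?_ ?_
      · have : List.IsChain arc (x :: (B ++ x :: C)) := hch.right_of_append
        have e1 : x :: (B ++ x :: C) = (x :: B) ++ (x :: C) := by simp
        rw [e1] at this
        exact this.right_of_append
      · intro y hy z hz
        have hrel := hch.rel_getLast_head_of_append (List.cons_ne_nil h A) (List.cons_ne_nil _ _)
        simp only [List.head_cons] at hrel
        rw [List.getLast?_eq_getLast_of_ne_nil (List.cons_ne_nil h A)] at hy
        simp only [Option.mem_def, Option.some.injEq, List.head?_cons] at hy hz
        subst hy; subst hz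
        exact hrel
    have hlast : (h :: (A ++ x :: (B ++ x :: C))).getLast hl = ((h :: A) ++ x :: C).getLast
        (by simp) := by
      simp only [e0]
      rw [List.getLast_append_of_ne_nil _ (List.cons_ne_nil _ _),
        List.getLast_append_of_ne_nil _ (List.cons_ne_nil _ _)]
      have e1 : x :: (B ++ x :: C) = (x :: B) ++ (x :: C) := by simp
      simp only [e1]
      rw [List.getLast_append_of_ne_nil _ (List.cons_ne_nil _ _)]
    have hcl2 : ((h :: A) ++ x :: C).head (by simp) = ((h :: A) ++ x :: C).getLast (by simp) := by
      rw [← hlast]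
      simpa using hcl
    have hcl1 : (x :: (B ++ [x])).head (List.cons_ne_nil _ _) =
        (x :: (B ++ [x])).getLast (List.cons_ne_nil _ _) := by
      simp
    have hlen1 : (x :: (B ++ [x])).length ≤ N := by
      simp only [List.length_cons, List.length_append, List.length_nil] at hlen ⊢; omega
    have hlen2 : ((h :: A) ++ x :: C).length ≤ N := by
      simp only [List.length_cons, List.length_append] at hlen ⊢; omega
    have z1 := ih _ (List.cons_ne_nil _ _) hlen1 hch1 hcl1
    have z2 := ih _ (by simp) hlen2 hch2 hcl2
    -- weights: W l = W ((h::A) ++ [x]) + W ((x::B) ++ [x]) + W (x :: C) = W piece2 + W piece1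
    have w0 := sum_zipWith_append_cons Λ (h :: A) (B ++ x :: C) x
    have w1 := sum_zipWith_append_cons Λ (x :: B) C x
    have w2 := sum_zipWith_append_cons Λ (h :: A) C x
    simp only [List.cons_append] at w0 w1 w2 z1 z2 ⊢
    rw [w0, w1]
    rw [w2] at z2
    have e2 : x :: (B ++ [x]) = x :: (B ++ [x]) := rfl
    linarith

/-- Concatenation of walks at a shared endpoint. -/
theorem isChain_append_walk (u v : α) (l₁ l₂ : List α)
    (h₁ : List.IsChain arc (u :: l₁)) (e₁ : (u :: l₁).getLast (List.cons_ne_nil _ _) = v)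
    (h₂ : List.IsChain arc (v :: l₂)) :
    List.IsChain arc (u :: (l₁ ++ l₂)) ∧
      (u :: (l₁ ++ l₂)).getLast (List.cons_ne_nil _ _) =
        (v :: l₂).getLast (List.cons_ne_nil _ _) ∧
      (List.zipWith Λ (u :: (l₁ ++ l₂)) (u :: (l₁ ++ l₂)).tail).sum =
        (List.zipWith Λ (u :: l₁) (u :: l₁).tail).sum +
          (List.zipWith Λ (v :: l₂) (v :: l₂).tail).sum := by
  induction l₁ generalizing u with
  | nil =>
    simp only [List.getLast_singleton] at e₁
    subst e₁
    refine ⟨by simpa using h₂, by simp, by simp⟩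
  | cons b t ih =>
    have hub : arc u b := h₁.rel
    have ht : List.IsChain arc (b :: t) := (List.isChain_cons_cons.1 h₁).2
    have e' : (b :: t).getLast (List.cons_ne_nil _ _) = v := by
      rw [List.getLast_cons_cons] at e₁; exact e₁
    obtain ⟨c1, c2, c3⟩ := ih b ht e'
    refine ⟨?_, ?_, ?_⟩
    · simp only [List.cons_append]
      exact List.IsChain.cons_cons hub c1
    · simp only [List.cons_append, List.getLast_cons_cons]
      exact c2
    · simp only [List.cons_append] at c3 ⊢
      rw [sum_zipWith_cons_cons, sum_zipWith_cons_cons, c3]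
      ring

/-- **Return walks.**  If every arc can be walked back, so can every walk. -/
theorem exists_return_walk
    (HB : ∀ u v, arc u v → ∃ l : List α, List.IsChain arc (v :: l) ∧
      (v :: l).getLast (List.cons_ne_nil _ _) = u) :
    ∀ (l₁ : List α) (u v : α), List.IsChain arc (u :: l₁) →
      (u :: l₁).getLast (List.cons_ne_nil _ _) = v →
      ∃ l₂ : List α, List.IsChain arc (v :: l₂) ∧ (v :: l₂).getLast (List.cons_ne_nil _ _) = u := by
  intro l₁
  induction l₁ with
  | nil =>
    intro u v _ e
    simp only [List.getLast_singleton] at e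
    subst e
    exact ⟨[], List.isChain_singleton _, rfl⟩
  | cons b t ih =>
    intro u v h e
    have hub : arc u b := h.rel
    have ht : List.IsChain arc (b :: t) := (List.isChain_cons_cons.1 h).2
    have e' : (b :: t).getLast (List.cons_ne_nil _ _) = v := by
      rw [List.getLast_cons_cons] at e; exact e
    obtain ⟨m₁, hm₁, em₁⟩ := ih b v ht e'      -- v ⇝ b
    obtain ⟨m₂, hm₂, em₂⟩ := HB u b hub         -- b ⇝ u
    obtain ⟨c1, c2, -⟩ := isChain_append_walk arc (fun _ _ => (0 : ℤ)) v b m₁ m₂ hm₁ em₁ hm₂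
    exact ⟨m₁ ++ m₂, c1, c2.trans em₂⟩

/-- **Potentials.**  If every arc can be walked back and every simple closed walk has weight `0`,
there is a potential `φ` with `φ v = φ u + Λ u v` along every arc. -/
theorem exists_potential
    (HB : ∀ u v, arc u v → ∃ l : List α, List.IsChain arc (v :: l) ∧
      (v :: l).getLast (List.cons_ne_nil _ _) = u)
    (HS : ∀ (l : List α) (hl : l ≠ []), List.IsChain arc l → l.head hl = l.getLast hl →
      l.tail.Nodup → (List.zipWith Λ l l.tail).sum = 0) :
    ∃ φ : α → ℤ, ∀ u v, arc u v → φ v = φ u + Λ u v := by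
  classical
  -- mutual reachability is an equivalence relation (symmetric by `HB`)
  have hsymm : ∀ u v, Relation.ReflTransGen arc u v → Relation.ReflTransGen arc v u := by
    intro u v h
    obtain ⟨l, hl, el⟩ := List.exists_isChain_cons_of_relationReflTransGen h
    obtain ⟨l', hl', el'⟩ := exists_return_walk arc HB l u v hl el
    exact List.relationReflTransGen_of_exists_isChain_cons l' hl' el'
  let S : Setoid α := ⟨Relation.ReflTransGen arc,
    ⟨fun _ => Relation.ReflTransGen.refl, fun h => hsymm _ _ h, fun h1 h2 => h1.trans h2⟩⟩
  let root : α → α := fun v => (Quotient.mk S v).out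
  have hroot : ∀ v, Relation.ReflTransGen arc (root v) v := fun v => Quotient.mk_out (s := S) v
  have hroot_eq : ∀ u v, arc u v → root u = root v := by
    intro u v h
    have : Quotient.mk S u = Quotient.mk S v := Quotient.sound (Relation.ReflTransGen.single h)
    simp only [root, this]
  -- chosen walks from the root and their weights
  have hwalk : ∀ v, ∃ l : List α, List.IsChain arc (root v :: l) ∧
      (root v :: l).getLast (List.cons_ne_nil _ _) = v :=
    fun v => List.exists_isChain_cons_of_relationReflTransGen (hroot v)
  let φ : α → ℤ := fun v =>
    (List.zipWith Λ (root v :: (hwalk v).choose) (root v :: (hwalk v).choose).tail).sum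
  -- path independence
  have hindep : ∀ (r v : α) (l l' : List α), List.IsChain arc (r :: l) →
      (r :: l).getLast (List.cons_ne_nil _ _) = v → List.IsChain arc (r :: l') →
      (r :: l').getLast (List.cons_ne_nil _ _) = v →
      (List.zipWith Λ (r :: l) (r :: l).tail).sum = (List.zipWith Λ (r :: l') (r :: l').tail).sum := by
    intro r v l l' hl el hl' el'
    obtain ⟨q, hq, eq⟩ := exists_return_walk arc HB l r v hl el
    obtain ⟨c1, c2, c3⟩ := isChain_append_walk arc Λ r v l q hl el hq
    obtain ⟨c1', c2', c3'⟩ := isChain_append_walk arc Λ r v l' q hl' el' hq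
    have z := sum_zipWith_eq_zero_of_closed arc Λ HS _ (r :: (l ++ q)) (List.cons_ne_nil _ _)
      le_rfl c1 (by rw [c2, eq]; rfl)
    have z' := sum_zipWith_eq_zero_of_closed arc Λ HS _ (r :: (l' ++ q)) (List.cons_ne_nil _ _)
      le_rfl c1' (by rw [c2', eq]; rfl)
    linarith
  refine ⟨φ, fun u v huv => ?_⟩
  have hre : root v = root u := (hroot_eq u v huv).symm
  show (List.zipWith Λ (root v :: (hwalk v).choose) (root v :: (hwalk v).choose).tail).sum =
    (List.zipWith Λ (root u :: (hwalk u).choose) (root u :: (hwalk u).choose).tail).sum + Λ u v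
  obtain ⟨hwu, ewu⟩ := (hwalk u).choose_spec
  obtain ⟨hwv, ewv⟩ := (hwalk v).choose_spec
  generalize (hwalk u).choose = wu at hwu ewu ⊢
  generalize (hwalk v).choose = wv at hwv ewv ⊢
  clear_value φ root
  rw [hre] at hwv ewv ⊢
  -- extend the walk to `u` by the arc `u → v` and compare with the walk to `v`
  obtain ⟨c1, c2, c3⟩ := isChain_append_walk arc Λ (root u) u wu [v] hwu ewu
    (List.IsChain.cons_cons huv (List.isChain_singleton _))
  have key := hindep (root u) v (wu ++ [v]) wv c1 (by rw [c2]; rfl) hwv ewv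
  rw [← key, c3]
  simp

/-- The weight of the simple closed walk `c ++ [c.head]` is `Σ_{x ∈ c} Λ x (c.formPerm x)`. -/
theorem sum_zipWith_cycle_eq_sum_map_formPerm [DecidableEq α] (c : List α) (hc : c.Nodup)
    (hne : c ≠ []) :
    (List.zipWith Λ (c ++ [c.head hne]) (c ++ [c.head hne]).tail).sum =
      (c.map fun x => Λ x (c.formPerm x)).sum := by
  congr 1
  apply List.ext_getElem
  · simp
  · intro i h1 h2
    have hi : i < c.length := by simpa using h2
    rw [List.getElem_zipWith, List.getElem_map, List.getElem_tail]
    rw [List.getElem_append_left (by simpa using hi)]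
    rw [List.formPerm_apply_getElem c hc i hi]
    by_cases hlt : i + 1 < c.length
    · rw [List.getElem_append_left hlt]
      simp [Nat.mod_eq_of_lt hlt]
    · have hi1 : i + 1 = c.length := by omega
      rw [List.getElem_append_right (by omega)]
      simp [hi1, List.head_eq_getElem_zero]

/-- Along the simple closed walk `c ++ [c.head]`, `c.formPerm` steps along arcs. -/
theorem arc_formPerm_of_isChain_cycle [DecidableEq α] (c : List α) (hc : c.Nodup) (hne : c ≠ [])
    (hch : List.IsChain arc (c ++ [c.head hne])) : ∀ x ∈ c, arc x (c.formPerm x) := by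
  intro x hx
  obtain ⟨i, hi, rfl⟩ := List.mem_iff_getElem.1 hx
  rw [List.formPerm_apply_getElem c hc i hi]
  rw [List.isChain_iff_getElem] at hch
  have hlen : (c ++ [c.head hne]).length = c.length + 1 := by simp
  have hstep := hch i (by rw [hlen]; omega)
  rw [List.getElem_append_left hi] at hstep
  by_cases hlt : i + 1 < c.length
  · rw [List.getElem_append_left hlt] at hstep
    simpa [Nat.mod_eq_of_lt hlt] using hstep
  · have hi1 : i + 1 = c.length := by omega
    rw [List.getElem_append_right (by omega)] at hstep
    simpa [hi1, List.head_eq_getElem_zero] using hstep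

end Walks

end Summit.ValiantsHypothesis.ValiantsHypothesis.Theorems.PolyaContinuedMonotoneCoverHard
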